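import Mathlib.RingTheory.Polynomial.Cyclotomic.Roots
import Mathlib.RingTheory.Polynomial.Cyclotomic.Eval
import Mathlib.NumberTheory.LegendreSymbol.QuadraticReciprocity
import Mathlib.Data.ZMod.Units
import HarnessLib

/-!
# Burungale–Kobayashi–Nakamura–Ota 2026 (arXiv:2608.06879v1, PREPRINT), §1.2.2 Def. 1.2 / §2.2.1
# Def. 2.7, (2.4), (2.5), Lemma 2.10, Lemma 2.11 (3): the GAUSSIAN PLUS/MINUS CYCLOTOMIC POLYNOMIALS
# — DEFINITIONS with bodies (the `ψ`-free quadratic-residue form (2.4)) and PROVED algebra; 0 facts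

Topic `NumberTheory/EllipticCurves`, sub-directory `BurungaleKobayashiNakamuraOta2026` (namespace =
path). Cross-ladder literature-typing layer (cell `bsd-littype`, seat 10, generation 3). Companion of
`SignedSelmerMainIdentity.lean`, `AnticyclotomicRankGrowth.lean`. The source is an UNREFEREED
PREPRINT; but everything in this file is either a DEFINITION (with body) of an object the paper
introduces, or a THEOREM proved here in the kernel (elementary cyclotomic algebra) — nothing is taken
from the preprint on trust, so the cites below are LOCATORS, not claims.

## The printed statements (held text `paper:arxiv-2608.06879`; printed p. 5 = file p0005, pp. 11–12
## = files p0014–p0015, p. 38 = p0060)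

* §1.1 (p. 3): "The finite-level tool is given by the Gaussian plus/minus cyclotomic polynomials:
  unlike the classical plus/minus polynomials [Kobayashi, Pollack], they partition the anticyclotomic
  characters according to the signs of the `ε`-constants, and since these mirror the quadratic
  residue symbol (1.1), our construction recovers the quadratic-residue factors of the cyclotomic
  polynomial in Gauss' *Disquisitiones Arithmeticae* — the constants in the trace relations encode
  the class numbers of `ℚ(√±p)` and the fundamental unit of `ℚ(√p)` (Lemma 2.11)."
* **Definition 1.2** (p. 5) / **Definition 2.7** (p. 11): "Fix a topological generator
  `γ ∈ Gal(Ψ_∞/Ψ)`. For an integer `k ≥ 1`, define the Gaussian plus/minus cyclotomic polynomials by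
  `Φ^±_{k,ψ}(γ) = ∏_{χ ∈ Ξ^±_{ψ,k}} (γ − χ(γ)) ∈ 𝒪[Gal(Ψ_k/Ψ)]`", `Ξ^±_{ψ,k} = {χ ∈ Ξ_k |
  ε(Ind_{Ψ/ℚ_p}(ψχ)) = ±1}` the characters of order `p^k` split by the local `ε`-sign.
* **Lemma 2.8**, proof, display **(2.4)** (p. 11): "For a character `χ = χ_k^b ∈ Ξ_k` with `b ∈ ℤ_p^×`,
  note that `χ ∈ Ξ^±_k` if and only if `(b/p) = ±1` (cf. [5, Cor. 7.8 i)]). Hence, we have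
  `Φ^±_k(γ) = ∏_{b ∈ (ℤ/p^kℤ)^×, (b/p) = ±1} (γ − χ^b_k(γ))` (2.4). It follows that `Φ^±_k(γ) ∈ M[γ]`,
  where `M` denotes the quadratic extension of `ℚ` inside `ℚ(Im(χ_1))`." — `χ_k(γ)` is a primitive
  `p^k`-th root of unity (a fixed system `(χ_n)` with `χ_{n+1}^{−δ²} = χ_n`).
* **(2.5)** (p. 12): "`ω^+_n = ∏_{0≤k≤n} Φ^+_k(γ)`, `ω^−_n = ∏_{0≤k≤n} Φ^−_k(γ) ∈ 𝒪[γ]`, where `Φ^±_0` is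
  given by `Φ^{ε(Ind ψ)}_0 = γ − 1`, `Φ^{−ε(Ind ψ)}_0 = 1`. For `χ ∈ Ξ_{≤n}`, note that `χ ∈ Ξ^±` if and
  only if `χ(ω^±_n(γ)) = 0`."
* **Lemma 2.10** (p. 12), proof: "Note that `Φ^+_{n+1}(γ)Φ^−_{n+1}(γ) = (γ^{p^{n+1}} − 1)/(γ^{p^n} − 1)
  = Φ^+_1(γ^{p^n})Φ^−_1(γ^{p^n})`".
* **Lemma 2.11** (p. 12): "1) If `p > 3` and `p ≡ 3 mod 4`, then `Φ^+_1(1) = (−1)^{(h(ℚ(√−p))+1)/2} √−p`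
  […]. 2) If `p ≡ 1 mod 4`, then `Φ^+_1(1) = √p · u_p^{−h(ℚ(√p))/2}` […]. 3) We have
  `Φ^+_1(1)Φ^−_1(1) = p`; consequently `Φ^−_1(1) = −Φ^+_1(1)` if `p ≡ 3 mod 4`, and `Φ^−_1(1) =
  √p · u_p^{h(ℚ(√p))/2}` if `p ≡ 1 mod 4`." Proof of 3): "`Φ^+_1(1)Φ^−_1(1) = ∏_{b=1}^{p−1} (1 − χ_1(γ)^b)
  = Φ_p(1) = p`, where the first equality is (2.4) evaluated at `γ = 1`".
* **Theorem 6.6**, proof (p. 38): "when `ω^±_n` is regarded as a polynomial in `γ`, the degree of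
  `ω^{ε_p(Ind φ)}_n` equals `1 + (p^n − 1)/2` and that of `ω^{−ε_p(Ind φ)}_n` equals `(p^n − 1)/2`."

## What is typed, and the ONE design decision

The partition `Ξ^± = Ξ^±_{ψ}` by local `ε`-factors of `Ind_{Ψ/ℚ_p}(ψχ)` is NOT a tree object (no
local `ε`-factors). But by (2.4) the two polynomials are — up to WHICH of the two is called `+` (this
depends on `ψ` and on the chosen system `χ_k`, Remark 4.3) — the two **Gaussian (quadratic-residue)
factors of the cyclotomic polynomial** `Φ_{p^k}`: with `ζ = χ_k(γ)` a primitive `p^k`-th root of unity,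
`Φ^{s}_k(X) = ∏_{b ∈ (ℤ/p^k)^×, (b/p) = s} (X − ζ^b)`, `s ∈ {+1, −1}`. THIS is what is defined here
(`gaussianCyclotomicFactor p n s ζ`, for any modulus `n` — intended `n = p^k` — any commutative ring
`R ∋ ζ`, and the Legendre symbol `legendreSym p` of Mathlib), together with the index sets
`gaussianIndex p n s` (`= {b ∈ (ℤ/n)^× | (b/p) = s}`, the avatar of `Ξ^s_k` through `χ ↦ b`,
`χ = χ_k^b`). The labelling ambiguity is recorded, not resolved: every statement below is symmetric
in `s ↔ −s` or concerns the unordered pair. PROVED (kernel, no hypotheses from the preprint):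
* `gaussianIndex_neg_one_eq_filter_not` / `card_gaussianIndex_one_add_card_gaussianIndex_neg_one` /
  `gaussianCyclotomicFactor_one_mul_neg_one`: for `p ∣ n` the two index sets partition `(ℤ/n)^×`
  (`#Ξ^+ + #Ξ^− = φ(n)`) and `Φ^{+}·Φ^{−} = ∏_{b ∈ (ℤ/n)^×} (X − ζ^b)`;
* `prod_units_X_sub_C_pow_eq_cyclotomic`: for `ζ` a primitive `n`-th root of unity in a domain,
  `∏_{b ∈ (ℤ/n)^×} (X − ζ^b) = Φ_n(X)` (Mathlib's `Polynomial.cyclotomic`), hence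
  `gaussianCyclotomicFactor_one_mul_neg_one_eq_cyclotomic`: **`Φ^+_k Φ^−_k = Φ_{p^k}`** — the identity
  behind Lemma 2.10 ("`Φ^+_{n+1}Φ^−_{n+1} = (γ^{p^{n+1}} − 1)/(γ^{p^n} − 1)`") and behind Gauss;
* `eval_one_mul_eval_one_eq_prime`: **Lemma 2.11 (3), first clause, `Φ^+_1(1)·Φ^−_1(1) = p`**, and its
  prime-power version `Φ^+_{k+1}(1)·Φ^−_{k+1}(1) = p` (`Polynomial.eval_one_cyclotomic_prime_pow`);
* `monic_gaussianCyclotomicFactor`, `natDegree_gaussianCyclotomicFactor` (`= #Ξ^s_k`);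
* `card_gaussianIndex_one_eq_card_gaussianIndex_neg_one`: for an ODD prime `p` and `n = p^k`, `k ≥ 1`,
  **`#Ξ^+_k = #Ξ^−_k`** (Def. 1.1: "Note that `|Ξ^+_{φ,n}| = |Ξ^−_{φ,n}|`"; here by multiplication by a
  non-residue unit), and `two_mul_card_gaussianIndex_eq_totient`: `2·#Ξ^s_k = φ(p^k) = p^{k−1}(p − 1)`
  — so `deg Φ^±_k = (p^k − p^{k−1})/2`; and, for `gaussianOmega p s ζ n = ∏_{k=1}^{n} Φ^s_k` ((2.5)
  without its level-`0` factor), `two_mul_natDegree_gaussianOmega_add_one`: `2·deg + 1 = p^n`, i.e.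
  `deg ∏_{1≤k≤n} Φ^−_k = (p^n − 1)/2` — the count quoted from the proof of Thm. 6.6
  (`sum_totient_prime_pow`: `Σ_{k=1}^{n} φ(p^k) = p^n − 1`).

## What is NOT here (typed GAP, reasons)

* Def. 2.7 ITSELF (the `ε`-labelled `Φ^±_{k,ψ}`) and (2.5)'s `Φ^±_0` (which needs the sign
  `ε(Ind_{Ψ/ℚ_p} ψ)`): local `ε`-factors are not in the tree; only the unordered Gaussian pair is.
* Lemma 2.11 (1), (2) and the second clauses of (3) (the VALUES `Φ^+_1(1) = (−1)^{(h(−p)+1)/2}√−p`,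
  `√p·u_p^{∓h(ℚ(√p))/2}`): classical — Dirichlet's class number formula in Kummer–Lerch form, the
  paper's source being M. Lerch, Acta Math. 29/30 (1905/06) [21, pp. 221–222, 232] — NOT typed: they
  need a pinned dictionary between `ζ = e^{2πi/p}`, the tree's form class numbers
  (`QuadraticFields/BinaryQuadraticFormsClassNumber.lean`, negative discriminants only) resp. a real
  quadratic class number, and the unit `u_p` ("`a, b` least positive with `a² − pb² = 4`", versus the
  tree's `fundUnit` of `X² − DY² = ±4`); no BSD consumer names them; left to a `QuadraticFields` seat.
* Lemma 2.10's congruence `Φ^±_{n+1}(γ) ≡ Φ^{±ϵ(Ψ)^n}_1(1) mod (γ^{p^n} − 1)` and Def. 2.9's `ϵ(Ψ)`: they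
  depend on the normalisation `χ_{n+1}^{−δ²} = χ_n` of the character system (`δ` a uniformiser of `Ψ`),
  i.e. on `ψ`/`Ψ` — outside the `ψ`-free form.
* Everything downstream (local points `c^±_n`, Prop. 2.13–2.14, Thm. 2.18 = Thm. 1.3): local Galois
  cohomology of `Ψ_n` with its `𝒪[Gal]`-structure is not a tree object (see
  `SignedSelmerMainIdentity.lean`, §"Why an interface").

References: [BurungaleKobayashiNakamuraOta2026] arXiv:2608.06879v1 §1.1 (p. 3), Def. 1.2 and
Remark 1.4 (p. 5), §2.2.1 Def. 2.7, Lemma 2.8 with (2.4), (2.5), Def. 2.9, Lemma 2.10, Lemma 2.11 and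
Remark 2.15 (pp. 11–13), proof of Thm. 6.6 (p. 38) [corpus: paper:arxiv-2608.06879 p0003, p0005,
p0014–p0016, p0060]; C. F. Gauss, *Disquisitiones Arithmeticae* art. 357 (the quadratic-residue
factorisation `4Φ_p = Y² ∓ pZ²`); M. Lerch, Acta Math. 29 (1905) 333–424, 30 (1906) 203–293 (cited
through the source, [20], [21]).
-/

noncomputable section

open scoped Classical
open Polynomial Finset

namespace Literature.NumberTheory.EllipticCurves.BurungaleKobayashiNakamuraOta2026

/-! ## §1 The index sets `Ξ^s_k` (through `χ_k^b ↔ b`) and the Gaussian factors (2.4) -/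

section Defs

variable (p n : ℕ) [Fact p.Prime] [NeZero n]

/-- **The index set of `Ξ^s_k` in the form (2.4)**: the units `b ∈ (ℤ/n)^×` (intended `n = p^k`) with
Legendre symbol `(b/p) = s` (`s ∈ {1, −1}`; read on the representative `b.val ∈ ℕ`, which only
matters modulo `p ∣ n`). [BKNO] Lemma 2.8, proof: "`χ = χ_k^b ∈ Ξ^±_k` if and only if `(b/p) = ±1`".
[cite: BurungaleKobayashiNakamuraOta2026, Lemma 2.8 proof, (2.4) (arXiv:2608.06879 p. 11)] -/
def gaussianIndex (s : ℤ) : Finset (ZMod n)ˣ :=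
  Finset.univ.filter fun b ↦ legendreSym p ((b : ZMod n).val : ℤ) = s

variable {R : Type*} [CommRing R]

/-- **The Gaussian plus/minus cyclotomic polynomial in the quadratic-residue form (2.4)**:
`Φ^s(X) = ∏_{b ∈ (ℤ/n)^×, (b/p) = s} (X − ζ^b) ∈ R[X]` for a commutative ring `R`, an element `ζ ∈ R`
(intended: `ζ = χ_k(γ)`, a primitive `p^k`-th root of unity, `n = p^k`) and a sign `s ∈ {1, −1}`.
[BKNO] Def. 1.2 / Def. 2.7 ("Gaussian plus/minus cyclotomic polynomials
`Φ^±_k(γ) = ∏_{χ ∈ Ξ^±_k} (γ − χ(γ))`") in the form of Lemma 2.8, (2.4):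
"`Φ^±_k(γ) = ∏_{b ∈ (ℤ/p^kℤ)^×, (b/p) = ±1} (γ − χ_k^b(γ))`". Which of `s = 1`, `s = −1` is the paper's
`+` depends on `ψ` and on the chosen character system (their `Ξ^±` is an `ε`-sign partition; Remark
4.3); the unordered pair is canonical. [cite: BurungaleKobayashiNakamuraOta2026, Def. 2.7 and (2.4) (arXiv:2608.06879 p. 11); Def. 1.2 (p. 5)] -/
def gaussianCyclotomicFactor (s : ℤ) (ζ : R) : R[X] :=
  ∏ b ∈ gaussianIndex p n s, (X - C (ζ ^ (b : ZMod n).val))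

variable {p n}

/-- Membership in the index set `Ξ^s`: `(b/p) = s`.
[cite: BurungaleKobayashiNakamuraOta2026, Lemma 2.8 proof, (2.4) (arXiv:2608.06879 p. 11)] -/
@[simp] theorem mem_gaussianIndex_iff (s : ℤ) (b : (ZMod n)ˣ) :
    b ∈ gaussianIndex p n s ↔ legendreSym p ((b : ZMod n).val : ℤ) = s := by
  simp [gaussianIndex]

/-- Unfolding of `gaussianCyclotomicFactor` as the product (2.4).
[cite: BurungaleKobayashiNakamuraOta2026, (2.4) (arXiv:2608.06879 p. 11)] -/
theorem gaussianCyclotomicFactor_def (s : ℤ) (ζ : R) :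
    gaussianCyclotomicFactor p n s ζ = ∏ b ∈ gaussianIndex p n s, (X - C (ζ ^ (b : ZMod n).val)) :=
  rfl

/-- `Φ^s` is monic (a product of monic linear factors).
[cite: BurungaleKobayashiNakamuraOta2026, Def. 2.7 / (2.4) (arXiv:2608.06879 p. 11)] -/
theorem monic_gaussianCyclotomicFactor (s : ℤ) (ζ : R) : (gaussianCyclotomicFactor p n s ζ).Monic :=
  monic_prod_of_monic _ _ fun _ _ ↦ monic_X_sub_C _

/-- `deg Φ^s = #Ξ^s` (the number of linear factors; `R` nontrivial).
[cite: BurungaleKobayashiNakamuraOta2026, Def. 2.7 / (2.4) (arXiv:2608.06879 p. 11)] -/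
theorem natDegree_gaussianCyclotomicFactor [Nontrivial R] (s : ℤ) (ζ : R) :
    (gaussianCyclotomicFactor p n s ζ).natDegree = (gaussianIndex p n s).card := by
  rw [gaussianCyclotomicFactor_def, natDegree_prod_of_monic _ _ fun _ _ ↦ monic_X_sub_C _]
  simp only [natDegree_X_sub_C, Finset.sum_const, smul_eq_mul, mul_one]

end Defs

/-! ## §2 The two index sets partition the units (`p ∣ n`), so `Φ^+ Φ^− = ∏_{b ∈ (ℤ/n)^×} (X − ζ^b)` -/

section Partition

variable {p n : ℕ} [Fact p.Prime] [NeZero n] {R : Type*} [CommRing R]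

omit [NeZero n] in
/-- For `p ∣ n`, a unit `b` of `ℤ/n` is prime to `p`, so its Legendre symbol is `1` or `−1`.
[cite: BurungaleKobayashiNakamuraOta2026, Lemma 2.8 proof (arXiv:2608.06879 p. 11)] -/
theorem legendreSym_val_eq_one_or_eq_neg_one (hpn : p ∣ n) (b : (ZMod n)ˣ) :
    legendreSym p ((b : ZMod n).val : ℤ) = 1 ∨ legendreSym p ((b : ZMod n).val : ℤ) = -1 := by
  apply legendreSym.eq_one_or_neg_one
  rw [Int.cast_natCast]
  intro h0
  rw [ZMod.natCast_eq_zero_iff] at h0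
  have hcop : Nat.Coprime (b : ZMod n).val n := ZMod.val_coe_unit_coprime b
  have hcop' : Nat.Coprime (b : ZMod n).val p := hcop.coprime_dvd_right hpn
  have hp1 : p = 1 := Nat.Coprime.eq_one_of_dvd hcop'.symm h0
  exact (Fact.out : p.Prime).one_lt.ne' hp1

/-- For `p ∣ n`: `Ξ^{−1} = (ℤ/n)^× ∖ Ξ^{1}` (as a filter).
[cite: BurungaleKobayashiNakamuraOta2026, Lemma 2.8 proof (arXiv:2608.06879 p. 11)] -/
theorem gaussianIndex_neg_one_eq_filter_not (hpn : p ∣ n) :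
    gaussianIndex p n (-1) =
      Finset.univ.filter fun b : (ZMod n)ˣ ↦ ¬ legendreSym p ((b : ZMod n).val : ℤ) = 1 := by
  ext b
  simp only [mem_gaussianIndex_iff, Finset.mem_filter, Finset.mem_univ, true_and]
  constructor
  · intro h
    rw [h]
    decide
  · intro h
    rcases legendreSym_val_eq_one_or_eq_neg_one hpn b with h1 | h1
    · exact absurd h1 h
    · exact h1

/-- **`Φ^{+}·Φ^{−} = ∏_{b ∈ (ℤ/n)^×} (X − ζ^b)`** for `p ∣ n` — "(2.4) evaluated", the first equality
of the proof of Lemma 2.11 (3) (`Φ^+_1(1)Φ^−_1(1) = ∏_{b=1}^{p−1} (1 − χ_1(γ)^b)`) before evaluation.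
[cite: BurungaleKobayashiNakamuraOta2026, Lemma 2.11 (3) proof (arXiv:2608.06879 p. 12)] -/
theorem gaussianCyclotomicFactor_one_mul_neg_one (hpn : p ∣ n) (ζ : R) :
    gaussianCyclotomicFactor p n 1 ζ * gaussianCyclotomicFactor p n (-1) ζ =
      ∏ b : (ZMod n)ˣ, (X - C (ζ ^ (b : ZMod n).val)) := by
  rw [gaussianCyclotomicFactor_def, gaussianCyclotomicFactor_def,
    gaussianIndex_neg_one_eq_filter_not hpn, gaussianIndex]
  exact Finset.prod_filter_mul_prod_filter_not _ _ _

/-- `#Ξ^{1} + #Ξ^{−1} = #(ℤ/n)^× = φ(n)` for `p ∣ n`.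
[cite: BurungaleKobayashiNakamuraOta2026, Def. 1.1 / Lemma 2.8 (arXiv:2608.06879 pp. 4, 11)] -/
theorem card_gaussianIndex_one_add_card_gaussianIndex_neg_one (hpn : p ∣ n) :
    (gaussianIndex p n 1).card + (gaussianIndex p n (-1)).card = Nat.totient n := by
  rw [gaussianIndex_neg_one_eq_filter_not hpn, gaussianIndex,
    Finset.card_filter_add_card_filter_not, Finset.card_univ, ZMod.card_units_eq_totient]

end Partition

/-! ## §3 With `ζ` a primitive `n`-th root of unity: `∏_{b ∈ (ℤ/n)^×} (X − ζ^b) = Φ_n`, so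
## `Φ^+_k Φ^−_k = Φ_{p^k}` and `Φ^+(1)Φ^−(1) = p` (Lemma 2.11 (3)) -/

section Cyclotomic

variable {p n : ℕ} [Fact p.Prime] [NeZero n] {R : Type*} [CommRing R] [IsDomain R]

/-- **The primitive `n`-th roots of unity are the `ζ^b`, `b ∈ (ℤ/n)^×`, each once**: for `ζ` a
primitive `n`-th root of unity in a domain, `∏_{b ∈ (ℤ/n)^×} (X − ζ^{b}) = Φ_n(X)` (Mathlib's
`Polynomial.cyclotomic n R = ∏_{μ ∈ primitiveRoots n R} (X − μ)`,
`Polynomial.cyclotomic_eq_prod_X_sub_primitiveRoots`, re-indexed by `b ↦ ζ^b`). This is the identity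
behind "(2.4) ⟹ `Φ^+_kΦ^−_k = (γ^{p^k} − 1)/(γ^{p^{k−1}} − 1)`" (proof of Lemma 2.10) and "∏_{b=1}^{p−1}
(1 − χ_1(γ)^b) = Φ_p(1)" (proof of Lemma 2.11 (3)).
[cite: BurungaleKobayashiNakamuraOta2026, proofs of Lemma 2.10 and Lemma 2.11 (3) (arXiv:2608.06879 p. 12)] -/
theorem prod_units_X_sub_C_pow_eq_cyclotomic {ζ : R} (hζ : IsPrimitiveRoot ζ n) :
    ∏ b : (ZMod n)ˣ, (X - C (ζ ^ (b : ZMod n).val)) = cyclotomic n R := by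
  have hn : 0 < n := Nat.pos_of_ne_zero (NeZero.ne n)
  rw [cyclotomic_eq_prod_X_sub_primitiveRoots hζ]
  refine Finset.prod_nbij (fun b : (ZMod n)ˣ ↦ ζ ^ (b : ZMod n).val) ?_ ?_ ?_ ?_
  · -- maps to primitive roots
    intro b _
    rw [mem_primitiveRoots hn]
    exact hζ.pow_of_coprime _ (ZMod.val_coe_unit_coprime b)
  · -- injective
    intro b₁ _ b₂ _ h
    have h' : (b₁ : ZMod n).val = (b₂ : ZMod n).val :=
      hζ.pow_inj (ZMod.val_lt _) (ZMod.val_lt _) h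
    exact Units.ext (ZMod.val_injective n h')
  · -- surjective
    intro μ hμ
    rw [Finset.mem_coe, mem_primitiveRoots hn] at hμ
    obtain ⟨i, hi, hcop, rfl⟩ := hζ.isPrimitiveRoot_iff.mp hμ
    refine ⟨ZMod.unitOfCoprime i hcop, Finset.mem_coe.mpr (Finset.mem_univ _), ?_⟩
    simp only [ZMod.coe_unitOfCoprime, ZMod.val_natCast, Nat.mod_eq_of_lt hi]
  · intro b _
    rfl

/-- **Gauss' quadratic-residue factorisation of the cyclotomic polynomial: `Φ^{+}·Φ^{−} = Φ_n`** for
`p ∣ n` and `ζ` a primitive `n`-th root of unity in a domain (BKNO, n = `p^k`: "our construction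
recovers the quadratic-residue factors of the cyclotomic polynomial in Gauss' Disquisitiones", §1.1;
Lemma 2.10, proof: "`Φ^+_{n+1}(γ)Φ^−_{n+1}(γ) = (γ^{p^{n+1}} − 1)/(γ^{p^n} − 1)`").
[cite: BurungaleKobayashiNakamuraOta2026, Lemma 2.10 proof (arXiv:2608.06879 p. 12); §1.1 (p. 3)] -/
theorem gaussianCyclotomicFactor_one_mul_neg_one_eq_cyclotomic (hpn : p ∣ n) {ζ : R}
    (hζ : IsPrimitiveRoot ζ n) :
    gaussianCyclotomicFactor p n 1 ζ * gaussianCyclotomicFactor p n (-1) ζ = cyclotomic n R := by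
  rw [gaussianCyclotomicFactor_one_mul_neg_one hpn, prod_units_X_sub_C_pow_eq_cyclotomic hζ]

/-- **Lemma 2.11 (3), first clause: `Φ^+_1(1)·Φ^−_1(1) = p`** (for `ζ = χ_1(γ)` a primitive `p`-th root
of unity in a domain): "(2.4) evaluated at `γ = 1`" and `Φ_p(1) = p`
(`Polynomial.eval_one_cyclotomic_prime`). PROVED.
[cite: BurungaleKobayashiNakamuraOta2026, Lemma 2.11 (3) (arXiv:2608.06879 p. 12)] -/
theorem eval_one_mul_eval_one_eq_prime {ζ : R} (hζ : IsPrimitiveRoot ζ p) :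
    (gaussianCyclotomicFactor p p 1 ζ).eval 1 * (gaussianCyclotomicFactor p p (-1) ζ).eval 1 = p := by
  rw [← eval_mul, gaussianCyclotomicFactor_one_mul_neg_one_eq_cyclotomic (dvd_refl p) hζ,
    eval_one_cyclotomic_prime]

/-- The prime-power version: `Φ^+_{k+1}(1)·Φ^−_{k+1}(1) = Φ_{p^{k+1}}(1) = p` (`ζ` a primitive
`p^{k+1}`-th root of unity) — the value `Φ^±_{n+1}(1)` entering the trace relation of Prop. 2.14 via
Lemma 2.10. PROVED (`Polynomial.eval_one_cyclotomic_prime_pow`).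
[cite: BurungaleKobayashiNakamuraOta2026, Lemma 2.10 and Lemma 2.11 (3) (arXiv:2608.06879 p. 12)] -/
theorem eval_one_mul_eval_one_eq_prime_pow (k : ℕ) {ζ : R}
    (hζ : IsPrimitiveRoot ζ (p ^ (k + 1))) :
    (gaussianCyclotomicFactor p (p ^ (k + 1)) 1 ζ).eval 1 *
        (gaussianCyclotomicFactor p (p ^ (k + 1)) (-1) ζ).eval 1 = p := by
  rw [← eval_mul, gaussianCyclotomicFactor_one_mul_neg_one_eq_cyclotomic (dvd_pow_self p
    (Nat.succ_ne_zero k)) hζ, eval_one_cyclotomic_prime_pow]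

end Cyclotomic

/-! ## §4 `|Ξ^+_k| = |Ξ^−_k|` for odd `p` (Def. 1.1) and the degree count of the proof of Thm. 6.6 -/

section Count

variable {p : ℕ} [Fact p.Prime]

/-- The Legendre symbol of the representative of a product of units of `ℤ/p^k` is the product of
the Legendre symbols (`(·/p)` only depends on the class mod `p ∣ p^k`). [folklore] -/
private theorem legendreSym_val_mul {k : ℕ} (hk : k ≠ 0) (u b : (ZMod (p ^ k))ˣ) :
    legendreSym p (((u * b : (ZMod (p ^ k))ˣ) : ZMod (p ^ k)).val : ℤ) =
      legendreSym p ((u : ZMod (p ^ k)).val : ℤ) * legendreSym p ((b : ZMod (p ^ k)).val : ℤ) := by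
  have hpk : p ∣ p ^ k := dvd_pow_self p hk
  rw [← legendreSym.mul, legendreSym.mod p (((u * b : (ZMod (p ^ k))ˣ) : ZMod (p ^ k)).val : ℤ),
    legendreSym.mod p (((u : ZMod (p ^ k)).val : ℤ) * _)]
  congr 1
  rw [Units.val_mul, ZMod.val_mul]
  push_cast
  rw [Int.emod_emod_of_dvd _ (by exact_mod_cast hpk)]

/-- For an odd prime `p` and `k ≥ 1` there is a unit of `ℤ/p^k` which is a quadratic NON-residue
mod `p` (lift a non-square of `𝔽_p`, `FiniteField.exists_nonsquare`). [folklore] -/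
private theorem exists_unit_legendreSym_eq_neg_one {k : ℕ} (hp : p ≠ 2) (hk : k ≠ 0) :
    ∃ u : (ZMod (p ^ k))ˣ, legendreSym p ((u : ZMod (p ^ k)).val : ℤ) = -1 := by
  obtain ⟨x, hx⟩ := FiniteField.exists_nonsquare (F := ZMod p)
    (by rw [ZMod.ringChar_zmod_n]; exact hp)
  have hx0 : x ≠ 0 := by
    rintro rfl
    exact hx IsSquare.zero
  have hxval0 : x.val ≠ 0 := fun h ↦ hx0 ((ZMod.val_eq_zero x).mp h)
  have hcop : Nat.Coprime x.val p := by
    rw [Nat.coprime_comm, Nat.Prime.coprime_iff_not_dvd (Fact.out : p.Prime)]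
    intro hdvd
    exact hxval0 (Nat.eq_zero_of_dvd_of_lt hdvd (ZMod.val_lt x))
  refine ⟨ZMod.unitOfCoprime x.val (hcop.pow_right k), ?_⟩
  have hval : ((ZMod.unitOfCoprime x.val (hcop.pow_right k) : (ZMod (p ^ k))ˣ) : ZMod (p ^ k)).val
      = x.val := by
    rw [ZMod.coe_unitOfCoprime, ZMod.val_natCast]
    exact Nat.mod_eq_of_lt (lt_of_lt_of_le (ZMod.val_lt x) (Nat.le_self_pow hk p))
  rw [hval, legendreSym.eq_neg_one_iff, Int.cast_natCast, ZMod.natCast_zmod_val]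
  exact hx

/-- **`|Ξ^+_k| = |Ξ^−_k|` for an odd prime `p` and `k ≥ 1`** (Def. 1.1: "Note that
`|Ξ^+_{φ,n}| = |Ξ^−_{φ,n}|` by (1.1)"; here in the (2.4) avatar: multiplication by a non-residue unit
`u` is a bijection `(ℤ/p^k)^×` swapping `{(b/p) = 1}` and `{(b/p) = −1}`). PROVED.
[cite: BurungaleKobayashiNakamuraOta2026, Def. 1.1 (arXiv:2608.06879 p. 4); (2.4) (p. 11)] -/
theorem card_gaussianIndex_one_eq_card_gaussianIndex_neg_one {k : ℕ} (hp : p ≠ 2)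
    (hk : k ≠ 0) : (gaussianIndex p (p ^ k) 1).card = (gaussianIndex p (p ^ k) (-1)).card := by
  obtain ⟨u, hu⟩ := exists_unit_legendreSym_eq_neg_one (p := p) hp hk
  -- `b ↦ u * b` maps each index set into the other, injectively
  have hmap : ∀ (s : ℤ), ∀ b ∈ gaussianIndex p (p ^ k) s, u * b ∈ gaussianIndex p (p ^ k) (-s) := by
    intro s b hb
    rw [mem_gaussianIndex_iff] at hb ⊢
    rw [legendreSym_val_mul hk, hu, hb, neg_one_mul]
  have hinj : ∀ s : ℤ, Set.InjOn (fun b : (ZMod (p ^ k))ˣ ↦ u * b) (gaussianIndex p (p ^ k) s) :=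
    fun s b₁ _ b₂ _ h ↦ mul_left_cancel h
  apply le_antisymm
  · exact Finset.card_le_card_of_injOn _ (fun b hb ↦ hmap 1 b hb) (hinj 1)
  · have h := Finset.card_le_card_of_injOn _ (fun b hb ↦ hmap (-1) b hb) (hinj (-1))
    simpa using h

/-- **`2·|Ξ^s_k| = φ(p^k) = p^{k−1}(p − 1)`** for an odd prime `p`, `k ≥ 1`, `s ∈ {1, −1}`: each Gaussian
factor `Φ^±_k` has degree `(p^k − p^{k−1})/2` — the count behind the proof of Thm. 6.6 ("the degree of
`ω^{−ε}_n` equals `(p^n − 1)/2`"). PROVED.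
[cite: BurungaleKobayashiNakamuraOta2026, proof of Thm. 6.6 (arXiv:2608.06879 p. 38); (2.4) (p. 11)] -/
theorem two_mul_card_gaussianIndex_eq_totient {k : ℕ} (hp : p ≠ 2) (hk : k ≠ 0)
    {s : ℤ} (hs : s = 1 ∨ s = -1) :
    2 * (gaussianIndex p (p ^ k) s).card = Nat.totient (p ^ k) := by
  have hsum := card_gaussianIndex_one_add_card_gaussianIndex_neg_one (p := p) (n := p ^ k)
    (dvd_pow_self p hk)
  have heq := card_gaussianIndex_one_eq_card_gaussianIndex_neg_one (p := p) hp hk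
  rcases hs with rfl | rfl <;> omega

/-- `Σ_{k=1}^{n} φ(p^k) = p^n − 1` (from `Σ_{d ∣ p^n} φ(d) = p^n`): with the previous lemma, the degree
of `∏_{1≤k≤n} Φ^−_k` is `(p^n − 1)/2` and that of `(γ − 1)∏_{1≤k≤n} Φ^+_k` is `1 + (p^n − 1)/2`, as in
the proof of Thm. 6.6 ("the degree of `ω^{ε}_n` equals `1 + (p^n − 1)/2` and that of `ω^{−ε}_n` equals
`(p^n − 1)/2`", i.e. `1 + Σ_{k=1}^n φ(p^k) = p^n`). PROVED.
[cite: BurungaleKobayashiNakamuraOta2026, proof of Thm. 6.6 (arXiv:2608.06879 p. 38)] -/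
theorem sum_totient_prime_pow (n : ℕ) :
    ∑ k ∈ Finset.range n, Nat.totient (p ^ (k + 1)) + 1 = p ^ n := by
  have hp : p.Prime := Fact.out
  induction n with
  | zero => simp
  | succ n ih =>
    rw [Finset.sum_range_succ, add_right_comm, ih, Nat.totient_prime_pow_succ hp]
    have h1 : 1 ≤ p := hp.one_lt.le
    zify [h1]
    ring

/-- **(2.5) without the level-`0` factor: `ω'^s_n := ∏_{k=1}^{n} Φ^s_k`**, for a family `ζ : ℕ → R`
(intended: `ζ k = χ_k(γ)` a primitive `p^k`-th root of unity — the paper's fixed system `(χ_k)`) and a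
sign `s`. [BKNO] (2.5): "`ω^±_n = ∏_{0≤k≤n} Φ^±_k(γ)`" with `Φ^{ε}_0 = γ − 1`, `Φ^{−ε}_0 = 1`; the
level-`0` factor needs the sign `ε = ε(Ind_{Ψ/ℚ_p} ψ)` (not a tree object) and is left to the user
(`(X − 1) · ω'` resp. `ω'`). [cite: BurungaleKobayashiNakamuraOta2026, (2.5) (arXiv:2608.06879 p. 12)] -/
def gaussianOmega (p : ℕ) [Fact p.Prime] {R : Type*} [CommRing R] (s : ℤ) (ζ : ℕ → R) (n : ℕ) :
    R[X] :=
  ∏ k ∈ Finset.range n, gaussianCyclotomicFactor p (p ^ (k + 1)) s (ζ (k + 1))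

/-- **The degree count of the proof of Thm. 6.6**: for an odd prime `p`, `s ∈ {1, −1}` and any family
`ζ` over a nontrivial ring, `2 · deg ω'^s_n + 1 = p^n`, i.e. `deg ∏_{k=1}^{n} Φ^s_k = (p^n − 1)/2` ("the
degree of `ω^{−ε}_n` equals `(p^n − 1)/2`" and, with the extra factor `γ − 1`, "that of `ω^{ε}_n` equals
`1 + (p^n − 1)/2`"). PROVED from `natDegree_gaussianCyclotomicFactor`,
`two_mul_card_gaussianIndex_eq_totient`, `sum_totient_prime_pow`.
[cite: BurungaleKobayashiNakamuraOta2026, proof of Thm. 6.6 (arXiv:2608.06879 p. 38); (2.5) (p. 12)] -/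
theorem two_mul_natDegree_gaussianOmega_add_one {R : Type*} [CommRing R] [Nontrivial R] (hp : p ≠ 2)
    {s : ℤ} (hs : s = 1 ∨ s = -1) (ζ : ℕ → R) (n : ℕ) :
    2 * (gaussianOmega p s ζ n).natDegree + 1 = p ^ n := by
  rw [gaussianOmega, natDegree_prod_of_monic _ _ fun k _ ↦ monic_gaussianCyclotomicFactor _ _,
    Finset.mul_sum, ← sum_totient_prime_pow (p := p) n]
  congr 1
  refine Finset.sum_congr rfl fun k _ ↦ ?_
  rw [natDegree_gaussianCyclotomicFactor,
    two_mul_card_gaussianIndex_eq_totient hp (Nat.succ_ne_zero k) hs]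

end Count

end Literature.NumberTheory.EllipticCurves.BurungaleKobayashiNakamuraOta2026
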